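import Literature.Geometry.Lorentzian.KerrDecayHierarchy
import Literature.Geometry.Lorentzian.KerrHyperboloidalLeaves
import Literature.Geometry.Lorentzian.KerrSchildMultiplierCurrent
import HarnessLib

/-!
# The leaf fluxes of `KerrHyperboloidalFlux.lean` as coordinate multiplier currents:
# `T[ψ](V, W) = −∑_μ (J^V)^μ n_μ` on the leaves `{t* = τ + h(y)}`

(family `gr`; infrastructure for the far-region estimates behind statement **gr.S24** —
Dafermos–Rodnianski–Shlapentokh-Rothman, arXiv:1402.7034 = Ann. of Math. 183 (2016), §2.3, §3.3 —
joining the manifold-level energy vocabulary of `EnergyCurrents.lean` /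
`KerrHyperboloidalFlux.lean` to the coefficient-field framework of `KerrSchild.waveOperator`;
namespace `Literature.Geometry.Lorentzian.Kerr`)

The named fact `Kerr.dafermosRodnianski_pHierarchy_scri` (`KerrDecayHierarchy.lean`; the `p = 1, 2`
members of the Dafermos–Rodnianski `r^p` hierarchy in the far region of subextremal Kerr) and the
flux-decay statement `Kerr.drsr_corollary_3_1_scri_flux_decay` are phrased with the **manifold**
quantities `Kerr.leafFluxDensity M a h ψ τ y = T[ψ](V, W)(τ + h(y), y)` (`T` the stress–energy
tensor of `EnergyCurrents.lean` for the smooth Kerr metric, `V = −g♯dt*` the Kerr–Schild time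
vector, `W = −g♯d(t* − h)` the leaf normal), `Kerr.leafFlux = ∫⁻ leafFluxDensity dy`,
`Kerr.localLeafFlux`, `Kerr.farLeafFlux`, `Kerr.leafMassDensity`, `Kerr.localLeafMass`, whereas every
energy *identity* of the tree (`KerrSchildMultiplierEnergyIdentity.lean`,
`KerrSchildCutoffCurrent.lean`, `KerrSchildTruncatedCurrent.lean`) is phrased with the **coordinate**
currents `(J^X)^μ = T^μ{}_ν X^ν` (`KerrSchild.multiplierCurrent G X w`) of a coefficient field `G`,
a multiplier `X` and a function `w` on `ℝ⁴`, and the flux `∑_μ J^μ n_μ dy` through graphs,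
`n = dt − dF` (`Kerr.graphConormal`). This file proves that for `G = g⁻¹_{M,a}`
(`Kerr.inverseMetric`), `w = Φ` any representative of `ψ` (e.g. its extension by zero) and the
graph `F = h`, the two agree, with the dominant-energy sign convention "energy `= −`flux":

* `Kerr.covector_graphConormal_apply` — the coordinate conormal `(1, −∂₁h, −∂₂h, −∂₃h)` of
  `KerrEnergyIdentity.lean` *is* the conormal `d(t* − h∘spatial)` of `KerrHyperboloidalFlux.lean`:
  `∑_μ n_μ v^μ = v⁰ − dh(v⃗)`;
* `Kerr.sum_multiplierCurrent_mul_eq_stressEnergy` — **`∑_μ (J^X)^μ n_μ = T[ψ](X, g♯n)`** at a point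
  of a chart domain `{r > r₀}`, for the Kerr inverse metric, any multiplier `X` and any coordinate
  covector `n` (the general-multiplier form of `Kerr.sum_tCurrent_mul_eq_stressEnergy`, which is
  the case `X = ∂_{t*}`); Dafermos–Rodnianski arXiv:0811.0354, App. D: `J^X_μ n^μ = T(X, n♯)`;
* `Kerr.leafNormal_eq_neg_coSharp` — `W = −g♯(∑ n_μ dx^μ)` with `n = graphConormal h y`;
* `Kerr.stressEnergy_timeVector_leafNormal_eq` — **`T[ψ](V, W) = −∑_μ (J^V)^μ n_μ`** at every
  point of the exterior, hence `Kerr.leafFluxDensity_eq_ofReal`: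
  `leafFluxDensity M a h ψ τ y = ENNReal.ofReal (−∑_μ (J^V)^μ n_μ)(τ + h(y), y)` at leaf points of
  the exterior, and `Kerr.leafMassDensity_eq_ofReal`: `leafMassDensity = ENNReal.ofReal (Φ²)`;
  the versions `…_extend` for the extension by zero of a smooth `ψ`;
* `Kerr.neg_sum_multiplierCurrent_timeVector_nonneg_scriHeight` — for `|a| < M`, `R₁ > 2M`, the
  coordinate energy density `−∑_μ (J^V)^μ n_μ` through the leaves `Σ̃_τ(h♯_{R₁})` is `≥ 0` at every
  exterior point (dominant energy condition, `Kerr.stressEnergy_timeVector_leafNormal_scriHeight_nonneg`),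
  so that `ENNReal.ofReal` truncates nothing and the monotone-convergence lemmas of
  `KerrSchildTruncatedCurrent.lean` apply to these densities.

With these identifications an energy identity for the cut-off current `f J^V` between two leaves
`Σ̃_s(h)`, `Σ̃_t(h)` (`KerrSchild.cutoffModifiedCurrent_graph_identity_timeCutoff` with `X = V`,
`ϖ = 0`) is a statement about `∫ f · leafFluxDensity`, i.e. about `Kerr.leafFlux`,
`Kerr.localLeafFlux`, `Kerr.farLeafFlux` — the currency of `Kerr.dafermosRodnianski_pHierarchy_scri`.
No definitions, no named facts (D-0026).

## References

* M. Dafermos, I. Rodnianski, Y. Shlapentokh-Rothman, arXiv:1402.7034 = Ann. of Math. 183 (2016),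
  §2.3.1 (`J^V_μ = T_{μν}V^ν`), §2.3.2, §3.1 (footnote on `N`), §3.3 (fluxes through `Σ̃_τ`)
  (key `DafermosRodnianskiShlapentokhrothman2014`).
* M. Dafermos, I. Rodnianski, *Lectures on black holes and linear waves*, arXiv:0811.0354, §13 =
  App. D (`T_{μν}`, `J^X_μ n^μ = T(X, n♯)`) (key `DafermosRodnianski2008`).
* R. P. Kerr, A. Schild (1965), §2 (`g⁻¹ = η⁻¹ − 2Hℓ♯ ⊗ ℓ♯`) (key `KerrSchild1965`).
-/

noncomputable section

open Bundle Set TopologicalSpace Filter MeasureTheory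
open scoped Manifold ContDiff Topology ENNReal

namespace Literature.Geometry.Lorentzian

namespace Kerr

/-! ### The coordinate conormal of a graph is the leaf conormal -/

/-- A continuous linear functional on `E3` is determined by its values on the coordinate vectors:
`q(u) = ∑_i u^i q(e_i)`. [folklore] -/
theorem _root_.Literature.Geometry.Lorentzian.E3.clm_apply_eq_sum (q : E3 →L[ℝ] ℝ) (u : E3) :
    q u = ∑ i : Fin 3, u i * q (EuclideanSpace.single i 1) := by
  conv_lhs => rw [← (EuclideanSpace.basisFun (Fin 3) ℝ).sum_repr u]
  simp only [map_sum, map_smul, smul_eq_mul, EuclideanSpace.basisFun_apply,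
    EuclideanSpace.basisFun_repr]

/-- **The coordinate conormal `(1, −∂₁h, −∂₂h, −∂₃h)` of the graph `{t* = τ + h(y)}`
(`Kerr.graphConormal`, `KerrEnergyIdentity.lean`) is the conormal `d(t* − h∘spatial)`
(`Kerr.leafConormal`, `KerrHyperboloidalFlux.lean`)**: `∑_μ n_μ(x⃗) v^μ = v⁰ − dh_{x⃗}(v⃗)` for every
`v ∈ ℝ⁴`. DRSR arXiv:1402.7034, §3.3 (`n_{Σ̃_τ}`). [folklore] -/
theorem covector_graphConormal_apply (h : E3 → ℝ) (x v : E4) :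
    E4.covector (graphConormal h (E4.spatial x)) v = leafConormal h x v := by
  rw [E4.covector_apply, leafConormal_apply, Fin.sum_univ_four,
    E3.clm_apply_eq_sum (fderiv ℝ h (E4.spatial x)) (E4.spatial v), Fin.sum_univ_three]
  simp only [graphConormal_zero, Fin.isValue, one_mul, E4.spatial_apply, Fin.succ_zero_eq_one,
    Fin.succ_one_eq_two]
  rw [show (1 : Fin 4) = (0 : Fin 3).succ from rfl, show (2 : Fin 4) = (1 : Fin 3).succ from rfl,
    show (3 : Fin 4) = (2 : Fin 3).succ from rfl, graphConormal_succ, graphConormal_succ,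
    graphConormal_succ]
  simp only [partialE3, Fin.succ_zero_eq_one, Fin.succ_one_eq_two]
  ring

/-- The same identity for the underlying linear maps. [folklore] -/
theorem covector_graphConormal_eq_leafConormal (h : E3 → ℝ) (x : E4) :
    ((E4.covector (graphConormal h (E4.spatial x)) : E4 →L[ℝ] ℝ) : E4 →ₗ[ℝ] ℝ) =
      leafConormal h x :=
  LinearMap.ext fun v ↦ covector_graphConormal_apply h x v

/-! ### `∑_μ (J^X)^μ n_μ = T[ψ](X, g♯n)` for the Kerr inverse metric -/

variable [Facts]

/-- **The coordinate multiplier current contracted with a covector is the stress–energy tensor**: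
for `ψ` on the chart domain `{r > r₀}` represented by `Φ` (`ψ = Φ` there) differentiable at `x`, a
multiplier field `X` with `X(x) = Y`, and a coordinate covector `n = ∑ n_μ dx^μ`,
`∑_μ (J^X)^μ(x) n_μ = T[ψ]_x (Y, g♯n)`, where `(J^X)^μ = T^μ{}_ν Y^ν` is
`KerrSchild.multiplierCurrent (Kerr.inverseMetric M a) X Φ x μ`, `T[ψ] = g.stressEnergy ψ x` for
`g = Kerr.smoothMetric M a r₀` and `g♯n = Kerr.coSharp M a x n`. The case `X = ∂_{t*}` is
`Kerr.sum_tCurrent_mul_eq_stressEnergy` (`KerrEnergyIdentity.lean`), whose proof is followed.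
Dafermos–Rodnianski arXiv:0811.0354, App. D (`J^X_μ n^μ = T(X, n♯)`); DRSR arXiv:1402.7034, §2.3.1.
[cite: DafermosRodnianski2008, App. D] -/
theorem sum_multiplierCurrent_mul_eq_stressEnergy (M a r₀ : ℝ) {ψ : region a r₀ → ℝ}
    {Φ : E4 → ℝ} (hψ : ∀ y, ψ y = Φ y) (x : region a r₀) (hΦ : DifferentiableAt ℝ Φ x)
    {X : E4 → Fin 4 → ℝ} {Y : E4} (hY : ∀ α, X x α = Y α) (n : Fin 4 → ℝ) :
    ∑ μ, KerrSchild.multiplierCurrent (inverseMetric M a) X Φ x μ * n μ =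
      (smoothMetric M a r₀).toPseudoRiemannianMetric.stressEnergy ψ x Y
        (coSharp M a x (E4.covector n : E4 →L[ℝ] ℝ)) := by
  have hx := radius_pos_of_mem_region x.2
  have hd : ∀ w : E4, mvfderiv 𝓘(ℝ, E4) ψ x w = fderiv ℝ Φ x w :=
    fun w ↦ OpensChart.mvfderiv_eq x ψ Φ hψ hΦ w
  -- components of `dΦ` and the expansion `dΦ(w) = ∑ w^μ p_μ`
  set p : Fin 4 → ℝ := fun μ ↦ fderiv ℝ Φ x (E4.basisVector μ) with hp
  have hPw : ∀ w : E4, fderiv ℝ Φ x w = ∑ μ, w μ * p μ := by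
    intro w
    conv_lhs => rw [eq_sum_basisVector w, map_sum]
    exact Finset.sum_congr rfl fun μ _ ↦ by rw [map_smul, smul_eq_mul]
  have hcov : ∀ w : E4, (E4.covector p : E4 →L[ℝ] ℝ) w = fderiv ℝ Φ x w := by
    intro w
    rw [E4.covector_apply, hPw]
    exact Finset.sum_congr rfl fun μ _ ↦ mul_comm _ _
  -- `♯dψ = g♯(∑ p_μ dx^μ)`
  have hsharp : (smoothMetric M a r₀).toPseudoRiemannianMetric.sharp x
      ((mvfderiv 𝓘(ℝ, E4) ψ x : TangentSpace 𝓘(ℝ, E4) x →L[ℝ] ℝ) :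
        TangentSpace 𝓘(ℝ, E4) x →ₗ[ℝ] ℝ) = coSharp M a x (E4.covector p : E4 →L[ℝ] ℝ) :=
    (smoothMetric M a r₀).sharp_eq_of_forall x _ _ fun w ↦ by
      show bilin M a x (coSharp M a x (E4.covector p : E4 →L[ℝ] ℝ)) w = mvfderiv 𝓘(ℝ, E4) ψ x w
      rw [bilin_coSharp M a hx, ContinuousLinearMap.coe_coe, hcov, hd w]
  -- expansion of `dΦ(g♯ m)` in coordinates
  have hexp : ∀ m : Fin 4 → ℝ, fderiv ℝ Φ x (coSharp M a x (E4.covector m : E4 →L[ℝ] ℝ)) =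
      ∑ ν, ∑ μ, inverseMetric M a x ν μ * m μ * p ν := by
    intro m
    rw [hPw]
    refine Finset.sum_congr rfl fun ν _ ↦ ?_
    rw [coSharp_covector_apply, Finset.sum_mul]
  -- the three `mvfderiv` values appearing in `T(Y, g♯n)`
  have hYd : mvfderiv 𝓘(ℝ, E4) ψ x Y = ∑ α, X x α * p α := by
    rw [hd, hPw]
    exact Finset.sum_congr rfl fun α _ ↦ by rw [hY]
  have hn : mvfderiv 𝓘(ℝ, E4) ψ x (coSharp M a x (E4.covector n : E4 →L[ℝ] ℝ)) =
      ∑ ν, ∑ μ, inverseMetric M a x ν μ * n μ * p ν := (hd _).trans (hexp n)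
  have hgrad : mvfderiv 𝓘(ℝ, E4) ψ x ((smoothMetric M a r₀).toPseudoRiemannianMetric.sharp x
      ((mvfderiv 𝓘(ℝ, E4) ψ x : TangentSpace 𝓘(ℝ, E4) x →L[ℝ] ℝ) :
        TangentSpace 𝓘(ℝ, E4) x →ₗ[ℝ] ℝ)) = ∑ ν, ∑ μ, inverseMetric M a x ν μ * p μ * p ν :=
    ((congrArg (mvfderiv 𝓘(ℝ, E4) ψ x) hsharp).trans (hd _)).trans (hexp p)
  -- `g(Y, g♯n) = n(Y) = ∑ X^μ n_μ`
  have hgY : (smoothMetric M a r₀).toPseudoRiemannianMetric.val x Y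
      (coSharp M a x (E4.covector n : E4 →L[ℝ] ℝ)) = ∑ μ, X x μ * n μ := by
    show bilin M a x Y (coSharp M a x (E4.covector n : E4 →L[ℝ] ℝ)) = ∑ μ, X x μ * n μ
    rw [bilin_symm, bilin_coSharp M a hx, ContinuousLinearMap.coe_coe, E4.covector_apply]
    exact Finset.sum_congr rfl fun μ _ ↦ by rw [hY, mul_comm]
  rw [PseudoRiemannianMetric.stressEnergy_apply, PseudoRiemannianMetric.gradSq_eq, hgrad, hgY,
    hYd, hn]
  -- the coordinate side: expand over `Fin 4` and use the symmetry of `g⁻¹`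
  have hp' : ∀ κ, fderiv ℝ Φ x (E4.basisVector κ) = p κ := fun κ ↦ rfl
  simp only [KerrSchild.multiplierCurrent, hp']
  have g10 := inverseMetric_symm M a x.1 1 0
  have g20 := inverseMetric_symm M a x.1 2 0
  have g30 := inverseMetric_symm M a x.1 3 0
  have g21 := inverseMetric_symm M a x.1 2 1
  have g31 := inverseMetric_symm M a x.1 3 1
  have g32 := inverseMetric_symm M a x.1 3 2
  simp only [Fin.sum_univ_four, Fin.isValue]
  rw [g10, g20, g30, g21, g31, g32]
  ring

/-! ### The leaf normal and the leaf flux density in coordinates -/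

/-- **The leaf normal is `−g♯` of the coordinate conormal**: `W = −g♯ d(t* − h) = −g♯(∑ n_μ dx^μ)`
with `n = graphConormal h x⃗ = (1, −∂₁h, −∂₂h, −∂₃h)` and `g♯ = Kerr.coSharp`
(`Kerr.sharp_smoothMetric`). DRSR arXiv:1402.7034, §3.3. [folklore] -/
theorem leafNormal_eq_neg_coSharp (M a : ℝ) (h : E3 → ℝ) (x : region a (rPlus M a)) :
    leafNormal M a h x =
      -coSharp M a x.1 (E4.covector (graphConormal h (E4.spatial x.1)) : E4 →L[ℝ] ℝ) := by
  unfold leafNormal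
  rw [sharp_smoothMetric, covector_graphConormal_eq_leafConormal]
  rfl

/-- **`T[ψ](V, W) = −∑_μ (J^V)^μ n_μ` on the leaves**: at every point `x` of the Kerr exterior,
for `ψ` represented by `Φ` differentiable at `x`, the flux density of `KerrHyperboloidalFlux.lean`
— the stress–energy tensor applied to the Kerr–Schild time vector `V = −g♯dt*` and the leaf normal
`W = −g♯d(t* − h)` — equals minus the coordinate `V`-current
`KerrSchild.multiplierCurrent (Kerr.inverseMetric M a) (x ↦ V(x)) Φ` contracted with the graph
conormal `n = (1, −∂₁h, −∂₂h, −∂₃h)` at `x⃗` ("energy `= −`flux", the sign convention of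
`KerrSchildMultiplierDEC.lean`). DRSR arXiv:1402.7034, §2.3.1 (`J^V_μ n^μ_{Σ̃}`), §3.3; Dafermos–Rodnianski
arXiv:0811.0354, App. D. [cite: DafermosRodnianskiShlapentokhrothman2014, §2.3.1 and §3.3] -/
theorem stressEnergy_timeVector_leafNormal_eq (M a : ℝ) {ψ : region a (rPlus M a) → ℝ}
    {Φ : E4 → ℝ} (hψ : ∀ y, ψ y = Φ y) (h : E3 → ℝ) (x : region a (rPlus M a))
    (hΦ : DifferentiableAt ℝ Φ x) :
    (smoothMetric M a (rPlus M a)).stressEnergy ψ x (timeVector M a x.1) (leafNormal M a h x) =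
      -∑ μ, KerrSchild.multiplierCurrent (inverseMetric M a) (fun z α ↦ timeVector M a z α) Φ x μ *
        graphConormal h (E4.spatial x.1) μ := by
  have key : (smoothMetric M a (rPlus M a)).stressEnergy ψ x (timeVector M a x.1)
      (-coSharp M a x.1 (E4.covector (graphConormal h (E4.spatial x.1)) : E4 →L[ℝ] ℝ)) =
      -∑ μ, KerrSchild.multiplierCurrent (inverseMetric M a) (fun z α ↦ timeVector M a z α) Φ x μ *
        graphConormal h (E4.spatial x.1) μ := by
    rw [show (smoothMetric M a (rPlus M a)).stressEnergy ψ x (timeVector M a x.1)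
        (-coSharp M a x.1 (E4.covector (graphConormal h (E4.spatial x.1)) : E4 →L[ℝ] ℝ)) =
        -(smoothMetric M a (rPlus M a)).stressEnergy ψ x (timeVector M a x.1)
          (coSharp M a x.1 (E4.covector (graphConormal h (E4.spatial x.1)) : E4 →L[ℝ] ℝ)) from
        LinearMap.BilinForm.neg_right _ _,
      sum_multiplierCurrent_mul_eq_stressEnergy M a (rPlus M a) hψ x hΦ
        (X := fun z α ↦ timeVector M a z α) (Y := timeVector M a x.1) (fun _ ↦ rfl)]
  unfold leafNormal
  rw [sharp_smoothMetric, ← covector_graphConormal_eq_leafConormal]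
  exact key

/-- **The leaf flux density of `KerrHyperboloidalFlux.lean` in coordinates**: at a point `y` whose
leaf point `(τ + h(y), y)` lies in the exterior `{r > r₊}`, and for `ψ` represented by `Φ`
differentiable there,
`leafFluxDensity M a h ψ τ y = ENNReal.ofReal (−∑_μ (J^V)^μ n_μ)(τ + h(y), y)` with
`(J^V)^μ = KerrSchild.multiplierCurrent (Kerr.inverseMetric M a) V Φ`, `n = Kerr.graphConormal h y`.
(Off the exterior the density is `0` by definition.) DRSR arXiv:1402.7034, §3.3.
[cite: DafermosRodnianskiShlapentokhrothman2014, §3.3] -/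
theorem leafFluxDensity_eq_ofReal (M a : ℝ) {ψ : region a (rPlus M a) → ℝ} {Φ : E4 → ℝ}
    (hψ : ∀ y, ψ y = Φ y) (h : E3 → ℝ) (τ : ℝ) {y : E3}
    (hy : leafPoint h τ y ∈ region a (rPlus M a)) (hΦ : DifferentiableAt ℝ Φ (leafPoint h τ y)) :
    leafFluxDensity M a h ψ τ y =
      ENNReal.ofReal (-∑ μ, KerrSchild.multiplierCurrent (inverseMetric M a)
        (fun z α ↦ timeVector M a z α) Φ (leafPoint h τ y) μ * graphConormal h y μ) := by
  rw [leafFluxDensity_of_mem h ψ τ hy, stressEnergy_timeVector_leafNormal_eq M a hψ h ⟨_, hy⟩ hΦ]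
  simp [leafPoint]

omit [Facts] in
/-- **The leaf mass density in coordinates**: at a point `y` whose leaf point lies in the exterior,
`leafMassDensity M a h ψ τ y = ENNReal.ofReal (Φ(τ + h(y), y)²)` for any representative `Φ` of `ψ`.
Dafermos–Rodnianski arXiv:0910.4957, §3–§4 (the zeroth-order terms `∫ φ²`). [folklore] -/
theorem leafMassDensity_eq_ofReal (M a : ℝ) {ψ : region a (rPlus M a) → ℝ} {Φ : E4 → ℝ}
    (hψ : ∀ y, ψ y = Φ y) (h : E3 → ℝ) (τ : ℝ) {y : E3}
    (hy : leafPoint h τ y ∈ region a (rPlus M a)) :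
    leafMassDensity M a h ψ τ y = ENNReal.ofReal (Φ (leafPoint h τ y) ^ 2) := by
  simp only [leafMassDensity, hy, dif_pos, hψ ⟨_, hy⟩]

/-! ### The representative `Φ = ψ̃`, the extension of `ψ` by zero -/

omit [Facts] in
/-- The extension by zero of a `C^∞` function on the exterior is differentiable at the points of the
exterior (`Literature.Geometry.Lorentzian.contDiffAt_extend`). [folklore] -/
theorem differentiableAt_extend_of_mem {M a : ℝ} {ψ : region a (rPlus M a) → ℝ}
    (hψ : ContMDiff 𝓘(ℝ, E4) 𝓘(ℝ, ℝ) ∞ ψ) {x : E4} (hx : x ∈ region a (rPlus M a)) :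
    DifferentiableAt ℝ (Function.extend Subtype.val ψ 0) x :=
  (contDiffAt_extend hψ ⟨x, hx⟩).differentiableAt (by simp)

/-- **The leaf flux density of a smooth `ψ` in coordinates, with the extension by zero as
representative**: `leafFluxDensity M a h ψ τ y = ENNReal.ofReal (−∑_μ (J^V)^μ[ψ̃] n_μ)(τ + h(y), y)`
at every `y` whose leaf point lies in the exterior. DRSR arXiv:1402.7034, §3.3.
[cite: DafermosRodnianskiShlapentokhrothman2014, §3.3] -/
theorem leafFluxDensity_eq_ofReal_extend (M a : ℝ) {ψ : region a (rPlus M a) → ℝ}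
    (hψ : ContMDiff 𝓘(ℝ, E4) 𝓘(ℝ, ℝ) ∞ ψ) (h : E3 → ℝ) (τ : ℝ) {y : E3}
    (hy : leafPoint h τ y ∈ region a (rPlus M a)) :
    leafFluxDensity M a h ψ τ y =
      ENNReal.ofReal (-∑ μ, KerrSchild.multiplierCurrent (inverseMetric M a)
        (fun z α ↦ timeVector M a z α) (Function.extend Subtype.val ψ 0) (leafPoint h τ y) μ *
          graphConormal h y μ) :=
  leafFluxDensity_eq_ofReal M a (extend_rep ψ) h τ hy (differentiableAt_extend_of_mem hψ hy)

omit [Facts] in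
/-- **The leaf mass density of `ψ` in coordinates, with the extension by zero as representative**:
`leafMassDensity M a h ψ τ y = ENNReal.ofReal (ψ̃(τ + h(y), y)²)` at every `y` whose leaf point lies
in the exterior. Dafermos–Rodnianski arXiv:0910.4957, §3–§4. [folklore] -/
theorem leafMassDensity_eq_ofReal_extend (M a : ℝ) (ψ : region a (rPlus M a) → ℝ) (h : E3 → ℝ)
    (τ : ℝ) {y : E3} (hy : leafPoint h τ y ∈ region a (rPlus M a)) :
    leafMassDensity M a h ψ τ y =
      ENNReal.ofReal (Function.extend Subtype.val ψ 0 (leafPoint h τ y) ^ 2) := by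
  have := extend_rep ψ ⟨_, hy⟩
  simp only [leafMassDensity, hy, dif_pos, this]

/-! ### The sign of the coordinate energy density through the leaves `Σ̃_τ(h♯_{R₁})` -/

/-- **The coordinate `V`-energy density through the leaves `Σ̃_τ(h♯_{R₁})` is non-negative**
(dominant energy condition; `V` and `W` are future-directed timelike for `|a| < M`, `R₁ > 2M`,
`Kerr.stressEnergy_timeVector_leafNormal_scriHeight_nonneg`): at every point `x` of the exterior and
for any representative `Φ` of a function `ψ` on the exterior, differentiable at `x`,
`0 ≤ −∑_μ (J^V)^μ[Φ](x) n_μ(x⃗)`, `n = graphConormal h♯_{R₁} x⃗`. So `ENNReal.ofReal` truncates nothing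
in `Kerr.leafFluxDensity_eq_ofReal`, and upper bounds for the cut-off integrals of
`KerrSchildTruncatedCurrent.lean` pass to the fluxes `Kerr.leafFlux` by monotone convergence.
DRSR arXiv:1402.7034, §3.1, §3.3. [cite: DafermosRodnianskiShlapentokhrothman2014, §3.1 and §3.3] -/
theorem neg_sum_multiplierCurrent_timeVector_nonneg_scriHeight [SliceFacts] {M a R₁ : ℝ}
    (hMa : IsSubextremal M a) (hR : 2 * M < R₁) {ψ : region a (rPlus M a) → ℝ} {Φ : E4 → ℝ}
    (hψ : ∀ y, ψ y = Φ y) (x : region a (rPlus M a)) (hΦ : DifferentiableAt ℝ Φ x) :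
    0 ≤ -∑ μ, KerrSchild.multiplierCurrent (inverseMetric M a) (fun z α ↦ timeVector M a z α) Φ x μ *
      graphConormal (scriHeight M a R₁) (E4.spatial x.1) μ := by
  rw [← stressEnergy_timeVector_leafNormal_eq M a hψ (scriHeight M a R₁) x hΦ]
  exact stressEnergy_timeVector_leafNormal_scriHeight_nonneg hMa hR ψ x

/-- The same for the extension by zero of a smooth `ψ`, at a leaf point of the exterior:
`0 ≤ −∑_μ (J^V)^μ[ψ̃] n_μ` at `(τ + h♯_{R₁}(y), y)`. DRSR arXiv:1402.7034, §3.1, §3.3.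
[cite: DafermosRodnianskiShlapentokhrothman2014, §3.1 and §3.3] -/
theorem neg_sum_multiplierCurrent_timeVector_nonneg_scriHeight_extend [SliceFacts] {M a R₁ : ℝ}
    (hMa : IsSubextremal M a) (hR : 2 * M < R₁) {ψ : region a (rPlus M a) → ℝ}
    (hψ : ContMDiff 𝓘(ℝ, E4) 𝓘(ℝ, ℝ) ∞ ψ) (τ : ℝ) {y : E3}
    (hy : leafPoint (scriHeight M a R₁) τ y ∈ region a (rPlus M a)) :
    0 ≤ -∑ μ, KerrSchild.multiplierCurrent (inverseMetric M a) (fun z α ↦ timeVector M a z α)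
      (Function.extend Subtype.val ψ 0) (leafPoint (scriHeight M a R₁) τ y) μ *
        graphConormal (scriHeight M a R₁) y μ := by
  have h := neg_sum_multiplierCurrent_timeVector_nonneg_scriHeight hMa hR (extend_rep ψ) ⟨_, hy⟩
    (differentiableAt_extend_of_mem hψ hy)
  simpa [leafPoint] using h

end Kerr

end Literature.Geometry.Lorentzian
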